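import Mathlib

/-!
# `MatrixDescartes` census — the ARROWHEAD LAGRANGE TOWER (definitions): an explicit real symmetric
# `(m,3)` pencil family towards `KThreeColumnLaw` (CONJECTURE A3, «ζ(m,3) = C(m+2,2) − 1 for every m»)

HONEST FRAMING.  Object-search cell `pub-symmetroid`, crux `Theses.LacunarySymmetroid.MatrixDescartes`
(stmt-ValiantsHypothesis-18050); seat val-sym-mdr-p1 (g2).  DEFINITIONS ONLY (data, no claims): the explicit objects of a
kernel port of the cell's THEOREM L (conjb-3 g3, `HOME/pub-symmetroid-conjb-3/ROUND3-MEMO.md` §1, paper-checked by conjb-1 g2 and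
theory g21) in a NEW bottom-up «arrowhead» form that needs no eigenvector existence, no Sylvester inertia and no Cauchy
interlacing: every step is secular partial-fraction algebra.  The companion proof files
(`…LagrangeTowerSecular`, `…LagrangeTowerAlternation`, `…LagrangeTowerFrame`, `…LagrangeTowerWalk`, `…FlagAsymptotics`,
`…KThreeColumnLawHolds`) prove that the size-`m` level of the tower, completed by the FLAG letter `x^D · diagonal (σ_a · thr a ^ (-D))`, is a real symmetric three-term lacunary pencil
`A + x·B + x^D·U_D` (support `(0,1,D)`) with at least `C(m+2,2) − 1` distinct positive determinant roots — so the `K = 3`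
column of the census is Descartes-extremal for EVERY `m` (a LOWER-bound / extremality statement in CONJECTURE-A currency; it
proves nothing about the crux `MatrixDescartes`, an upper-bound statement at fat formats, nor about `VP ≠ VNP`).

THE OBJECTS.  Windows: block size `k` has its `k` designed roots `zroot k i = 4^{-k}·(1 + (i+1)/(k+1))` in
`Ω_k = (4^{-k}, 2·4^{-k})`, test points `spt k r = 4^{-k}·(1 + (2r+1)/(2k+2))` (`r = 0..k`) interleaving them, and the
coordinate `a` of the flag letter switches on at the threshold `thr a = 3·4^{-(a+1)}` (between `Ω_{a+1}` and `Ω_a`).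
`TowerData k` = a symmetric linear pencil `A + x·B` of size `k` with a SPLIT FRAME `(U, W, β, θ)`:
`Wᵀ U = 1`, `Wᵀ (A + x B) W = diagonal (β_i (x − zroot k i))`, `sign β_i = θ·(−1)^i` (the predicate `TowerData.Good`).
`TowerData.step` borders a size-`k` level to size `k+1`: in the child's frame the parent is the arrowhead
`[[diagonal (β'_l (x − ν_l)), c], [cᵀ, η·L(x)]]` with `c_l² = −η·β'_l·r_l`, `r_l = P(ν_l)/N_l(ν_l)` and `L` the linear part of
the partial-fraction expansion `P/N = L + Σ_l r_l/(x − ν_l)` (`P = ∏ (x − zroot (k+1) i)`, `N = ∏ (x − zroot k l)`; `L` is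
pinned by two auxiliary nodes `5, 6` so that no coefficient bookkeeping is needed); the parent's frame is the matrix `V` of
the explicit kernel vectors `v_i = (−c_l/(β'_l (z_i − ν_l)))_l ⊕ (1)`, `W_new = (W ⊕ 1)·V`, `U_new = (U ⊕ 1)·B♭·V·diagonal(β_new⁻¹)`,
`β_new i = η·L' + Σ_l (c_l²/β'_l)/(z_i − ν_l)²`, `θ_new = η = θ·(−1)^k`.  `tower k` iterates from the empty pencil.
`sgn a` (the sign of the `a`-th flag coordinate) is read off the leading principal minors at two test points; `walk`/`pts` enumerate
the `C(m+2,2)` test points increasingly (window `m` first), `levelSign`/`Ewalk` are the limiting sign data per test point.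
Nothing here is evaluated or asserted; see the proof files for every property (all re-checked numerically in-seat for m ≤ 8:
`9, 20, 44` alternations at `m = 3, 5, 8`). [construction of the cell: conjb-3 g3 THEOREM L, re-routed]
-/

-- `Summit.ValiantsHypothesis.ValiantsHypothesis.…` repeats a component by the D-0017 layout
-- (single-conjunct summit), which the `dupNamespace` linter flags; the name is mandated.
set_option linter.dupNamespace false

noncomputable section

namespace Summit.ValiantsHypothesis.ValiantsHypothesis.Theorems.LacunarySymmetroidMatrixDescartes.Census.LagrangeTower

open Matrix Polynomial Finset
open scoped BigOperators

/-! ## Windows, roots, test points, thresholds -/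

/-- The `i`-th designed root of the size-`k` block: `4^{-k}·(1 + (i+1)/(k+1)) ∈ (4^{-k}, 2·4^{-k})`. [folklore] -/
def zroot (k : ℕ) (i : Fin k) : ℝ := ((4 : ℝ)⁻¹) ^ k * (1 + ((i : ℝ) + 1) / ((k : ℝ) + 1))

/-- The `r`-th test point of window `k` (`r = 0, …, k`): `4^{-k}·(1 + (2r+1)/(2k+2))`; `spt k r < zroot k r < spt k (r+1)`.
Window `0` has the single point `spt 0 0 = 3/2`. [folklore] -/
def spt (k r : ℕ) : ℝ := ((4 : ℝ)⁻¹) ^ k * (1 + (2 * (r : ℝ) + 1) / (2 * (k : ℝ) + 2))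

/-- The switch-on threshold of flag coordinate `a`: `3·4^{-(a+1)}`, strictly between the windows `Ω_{a+1}` and `Ω_a`. [folklore] -/
def thr (a : ℕ) : ℝ := 3 * ((4 : ℝ)⁻¹) ^ (a + 1)

/-! ## Tower data -/

/-- A size-`k` level of the tower: the symmetric linear pencil `A + x·B` together with a candidate split frame `(U, W, β, θ)`
(data only; the frame identities are the predicate `TowerData.Good`). [folklore] -/
structure TowerData (k : ℕ) where
  /-- constant letter -/
  A : Matrix (Fin k) (Fin k) ℝ
  /-- linear letter -/
  B : Matrix (Fin k) (Fin k) ℝ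
  /-- co-frame (`A + xB = U · diagonal · Uᵀ`) -/
  U : Matrix (Fin k) (Fin k) ℝ
  /-- frame of kernel vectors (`Wᵀ (A + xB) W = diagonal`) -/
  W : Matrix (Fin k) (Fin k) ℝ
  /-- sign characteristic -/
  β : Fin k → ℝ
  /-- orientation of the alternation, `±1` -/
  θ : ℝ

/-- The split-frame identities of a level: `θ = ±1`, `Wᵀ U = 1`, `Wᵀ (A + x B) W = diagonal (β_i (x − zroot k i))` for every
real `x`, and the sign characteristic alternates: `0 < θ (−1)^i β_i`. [folklore] -/
def TowerData.Good {k : ℕ} (d : TowerData k) : Prop :=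
  (d.θ = 1 ∨ d.θ = -1) ∧ d.Wᵀ * d.U = 1 ∧
    (∀ x : ℝ, d.Wᵀ * (d.A + x • d.B) * d.W = diagonal (fun i => d.β i * (x - zroot k i))) ∧
    ∀ i : Fin k, 0 < d.θ * (-1) ^ (i : ℕ) * d.β i

/-! ## The bordering step (secular / partial-fraction data) -/

section Step

variable {k : ℕ} (d : TowerData k)

/-- `P = ∏_i (X − zroot (k+1) i)`, the parent's designed characteristic polynomial. [folklore] -/
def Ppoly (k : ℕ) : ℝ[X] := ∏ i : Fin (k + 1), (X - C (zroot (k + 1) i))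

/-- `N = ∏_l (X − zroot k l)`, the child's characteristic polynomial. [folklore] -/
def Npoly (k : ℕ) : ℝ[X] := ∏ l : Fin k, (X - C (zroot k l))

/-- `N_l = ∏_{j ≠ l} (X − zroot k j)`. [folklore] -/
def Nlpoly (k : ℕ) (l : Fin k) : ℝ[X] := ∏ j ∈ univ.erase l, (X - C (zroot k j))

/-- Partial-fraction residue `r_l = P(ν_l) / N_l(ν_l)` at the child's root `ν_l = zroot k l`. [folklore] -/
def rcoef (k : ℕ) (l : Fin k) : ℝ := (Ppoly k).eval (zroot k l) / (Nlpoly k l).eval (zroot k l)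

/-- Value of the linear part `L = (P − Σ_l r_l N_l)/N` at a non-root `w`. [folklore] -/
def lval (k : ℕ) (w : ℝ) : ℝ :=
  ((Ppoly k).eval w - ∑ l, rcoef k l * (Nlpoly k l).eval w) / (Npoly k).eval w

/-- Slope of the linear part, read at the auxiliary nodes `5, 6` (it equals `1`, which is never used). [folklore] -/
def lslope (k : ℕ) : ℝ := lval k 6 - lval k 5

/-- Constant term of the linear part. [folklore] -/
def lconst (k : ℕ) : ℝ := lval k 5 - 5 * lslope k

/-- The linear part `L = lconst + lslope·X` as a polynomial. [folklore] -/
def Lpoly (k : ℕ) : ℝ[X] := C (lconst k) + C (lslope k) * X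

/-- Orientation of the new level: `η = θ·(−1)^k`. [folklore] -/
def ηnew : ℝ := d.θ * (-1) ^ k

/-- Arrow entries in the child's frame: `c_l = √(−η r_l β_l)` (the radicand is positive when `β` alternates with sign `θ`). [folklore] -/
def cvec (l : Fin k) : ℝ := Real.sqrt (-(ηnew d * rcoef k l * d.β l))

/-- Arrow entries in the original coordinates: `b = U c`. [folklore] -/
def bvec : Fin k → ℝ := d.U *ᵥ cvec d

/-- The secular function `ψ(x) = η L(x) − Σ_l (c_l²/β_l)/(x − ν_l)` (`= η P/N` off the child's roots). [folklore] -/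
def ψfun (x : ℝ) : ℝ := ηnew d * (Lpoly k).eval x - ∑ l, (cvec d l) ^ 2 / d.β l / (x - zroot k l)

/-- The derivative expression `ψ'(x) = η·lslope + Σ_l (c_l²/β_l)/(x − ν_l)²`. [folklore] -/
def ψder (x : ℝ) : ℝ := ηnew d * lslope k + ∑ l, (cvec d l) ^ 2 / d.β l / (x - zroot k l) ^ 2

/-- The new sign characteristic `β_new i = ψ'(zroot (k+1) i)`. [folklore] -/
def βnew (i : Fin (k + 1)) : ℝ := ψder d (zroot (k + 1) i)

/-- The parent pencil in the child's frame (Sum coordinates): constant letter of the arrowhead. [folklore] -/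
def Aflat : Matrix (Fin k ⊕ Fin 1) (Fin k ⊕ Fin 1) ℝ :=
  Matrix.fromBlocks (diagonal fun l => -(d.β l * zroot k l)) (replicateCol (Fin 1) (cvec d))
    (replicateRow (Fin 1) (cvec d)) (Matrix.of fun _ _ => ηnew d * lconst k)

/-- The parent pencil in the child's frame (Sum coordinates): linear letter of the arrowhead (diagonal). [folklore] -/
def Bflat : Matrix (Fin k ⊕ Fin 1) (Fin k ⊕ Fin 1) ℝ :=
  Matrix.fromBlocks (diagonal d.β) 0 0 (Matrix.of fun _ _ => ηnew d * lslope k)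

/-- Kernel vector of the arrowhead at the parent root `zroot (k+1) i`, in Sum coordinates. [folklore] -/
def kvec (i : Fin (k + 1)) : Fin k ⊕ Fin 1 → ℝ :=
  Sum.elim (fun l => -(cvec d l) / (d.β l * (zroot (k + 1) i - zroot k l))) (fun _ => 1)

/-- The matrix of kernel vectors (columns), in Sum coordinates. [folklore] -/
def Vflat : Matrix (Fin k ⊕ Fin 1) (Fin (k + 1)) ℝ := Matrix.of fun p i => kvec d i p

/-- The matrix of kernel vectors, rows re-indexed to `Fin (k+1)` through `finSumFinEquiv`. [folklore] -/
def Vsq : Matrix (Fin (k + 1)) (Fin (k + 1)) ℝ := (Vflat d).submatrix finSumFinEquiv.symm id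

/-- Border a square block by zero row/column and a `1` in the corner, on `Fin (k+1)`. [folklore] -/
def extendOne (M : Matrix (Fin k) (Fin k) ℝ) : Matrix (Fin (k + 1)) (Fin (k + 1)) ℝ :=
  Matrix.reindex finSumFinEquiv finSumFinEquiv (Matrix.fromBlocks M 0 0 (1 : Matrix (Fin 1) (Fin 1) ℝ))

/-- THE BORDERING STEP `k → k+1` (all data explicit). [folklore] -/
def step : TowerData (k + 1) where
  A := Matrix.reindex finSumFinEquiv finSumFinEquiv
    (Matrix.fromBlocks d.A (replicateCol (Fin 1) (bvec d)) (replicateRow (Fin 1) (bvec d))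
      (Matrix.of fun _ _ => ηnew d * lconst k))
  B := Matrix.reindex finSumFinEquiv finSumFinEquiv
    (Matrix.fromBlocks d.B 0 0 (Matrix.of fun _ _ => ηnew d * lslope k))
  U := extendOne d.U * Matrix.reindex finSumFinEquiv finSumFinEquiv (Bflat d) * Vsq d *
    diagonal (fun i => (βnew d i)⁻¹)
  W := extendOne d.W * Vsq d
  β := βnew d
  θ := ηnew d

end Step

/-- The empty level. [folklore] -/
def towerZero : TowerData 0 where
  A := 0
  B := 0
  U := 1
  W := 1
  β := fun _ => 1
  θ := 1

/-- THE ARROWHEAD LAGRANGE TOWER: level `k` is a symmetric `k × k` linear pencil whose leading `j × j` blocks are the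
levels `j ≤ k`. [folklore] -/
def tower : (k : ℕ) → TowerData k
  | 0 => towerZero
  | k + 1 => step (tower k)

/-- Leading principal `j × j` minor of the level-`k` pencil at the point `t` (for `j ≤ k`). [folklore] -/
def pminor (k j : ℕ) (h : j ≤ k) (t : ℝ) : ℝ :=
  Matrix.det (((tower k).A + t • (tower k).B).submatrix (Fin.castLE h) (Fin.castLE h))

/-- The sign letter of the flag: coordinate `a` carries `sgn a = −p_{a+1}(top test point of window a+1) · p_a(bottom test point of
window a)`, read on the tower levels themselves (`p_j(t) = det (level j at t)`). [folklore] -/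
def sgn (a : ℕ) : ℝ :=
  -(Matrix.det ((tower (a + 1)).A + spt (a + 1) (a + 1) • (tower (a + 1)).B) *
    Matrix.det ((tower a).A + spt a 0 • (tower a).B))

/-- The flag letter at size `m` and lacunarity `D`: `U_D = diagonal (sgn a · (thr a)^{-D})`. [folklore] -/
def flagLetter (m D : ℕ) : Matrix (Fin m) (Fin m) ℝ :=
  diagonal fun a : Fin m => sgn a * ((thr a)⁻¹) ^ D

/-- The witness family: the three letters `(A_m, B_m, U_D)` on the support `(0, 1, D)`. [folklore] -/
def witnessLetters (m D : ℕ) : Fin 3 → Matrix (Fin m) (Fin m) ℝ :=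
  ![(tower m).A, (tower m).B, flagLetter m D]

/-- The witness support `(0, 1, D)`. [folklore] -/
def witnessExps (D : ℕ) : Fin 3 → ℕ := ![0, 1, D]


/-! ## The test-point walk (window `m` first, then `m−1`, …, then window `0`) -/

/-- Triangular numbers `tri n = n(n+1)/2` (so `tri (m+1) = C(m+2,2)`). [folklore] -/
def tri : ℕ → ℕ
  | 0 => 0
  | n + 1 => tri n + (n + 1)

/-- The walk through the test points for size `m`: state `(j, r)` = test point `r` of window `j`; it moves `r ↦ r+1` inside a
window and jumps from the top of window `j` to the bottom of window `j−1`. [folklore] -/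
def walk (m : ℕ) : ℕ → ℕ × ℕ
  | 0 => (m, 0)
  | n + 1 => if (walk m n).2 < (walk m n).1 then ((walk m n).1, (walk m n).2 + 1) else ((walk m n).1 - 1, 0)

/-- The `n`-th test point of the size-`m` witness (increasing in `n` for `n ≤ tri (m+1) − 1`). [folklore] -/
def pts (m n : ℕ) : ℝ := spt (walk m n).1 (walk m n).2

/-- Product of the flag signs that are ON throughout window `j` (coordinates `a ≥ j`). [folklore] -/
def levelSign (m j : ℕ) : ℝ := ∏ a ∈ univ.filter (fun a : Fin m => j ≤ (a : ℕ)), sgn a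

/-- The limiting sign datum at the `n`-th test point: `(∏_{ON} sgn) · (leading minor of level j at the point)`. [folklore] -/
def Ewalk (m n : ℕ) : ℝ :=
  levelSign m (walk m n).1 * Matrix.det ((tower (walk m n).1).A + pts m n • (tower (walk m n).1).B)

end Summit.ValiantsHypothesis.ValiantsHypothesis.Theorems.LacunarySymmetroidMatrixDescartes.Census.LagrangeTower

end
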